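import Summits.NavierStokesRegularity.NavierStokesRegularity.Theses.AxisymmetricExtremality
import Literature.Analysis.FluidPDE.RusinSverakSingularPoint
import Literature.Analysis.FluidPDE.AxisymmetricTypeIBounded
import Literature.Analysis.FluidPDE.SereginSverakAxisymmetric
import Summits.NavierStokesRegularity.NavierStokesRegularity.Theorems.AxisymmetricExtremalityAxisymmetricKatoGlobalStubOffAxisBoundedOfLocalEnergy
import Summits.NavierStokesRegularity.NavierStokesRegularity.Theorems.AxisymmetricExtremalityAxisymmetricKatoGlobalStubAxisBoundedOfLocalEnergyOrigin
import Summits.NavierStokesRegularity.NavierStokesRegularity.Theorems.AxisymmetricExtremalityAxisymmetricKatoGlobalStubKatoLocalEnergyNearTop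
import Summits.NavierStokesRegularity.NavierStokesRegularity.Theorems.AxisymmetricExtremalityAxisymmetricKatoGlobalStubKatoAxisymSingularPoint
import HarnessLib.Audit

/-!
# Birth skeleton (BC3) of the crux `AxisymmetricExtremality.AxisymmetricKatoGlobal`

(crux item `stmt-NavierStokesRegularity-15453`, rank 3, route
`route-NavierStokesRegularity-AxisymmetricExtremality`; tree path
`Cruxes/AxisymmetricKatoGlobal/Lines/birth.lean`; registrar
`planner-skel-stmt-NavierStokesRegularity-15453-0`, 2026-08-17. The route predates the Lean birth
certificate; this file supplies BC3 retroactively.)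

THE CRUX (fixed, the route's decl): for every `ν > 0`, every `L³` field `u₀` represented in
`Ḣ^{1/2}`, weakly divergence free and axisymmetric about the `x₂`-axis (rotation-equivariance
written out; definitionally `IsAxisymmetric u₀`) has a global Kato (`C([0,∞); L³)` mild) solution —
axisymmetric-WITH-swirl global regularity in the critical class.

THE CUT — "blow-up ⇒ an axis-localised singular point ⇒ killed by the swirl's continuity at the
axis".  The one scalar structure the axisymmetric class owns is the swirl `Γ = x₀u₁ − x₁u₀ = r u_θ`
(`swirl`), which solves the drift–diffusion equation `∂ₜΓ + u·∇Γ = ν(ΔΓ − (2/r)∂ᵣΓ)`, obeys a maximum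
principle, is SCALE-INVARIANT under the Navier–Stokes scaling, and vanishes on the axis.  Every
positive result on axisymmetric flows with swirl is a statement that a modulus of continuity of `Γ`
AT THE AXIS forces regularity (Lei–Zhang 2017 Cor. 1.3, `|Γ| ≤ C₁|ln r|⁻²`; Wei 2016 Cor. 1.1,
`|ln r|^{-3/2}`; Seregin, J. Math. Fluid Mech. 24 (2022) = arXiv:2201.00153, Thm. 1.2 with §2: the
LOCAL version for suitable weak solutions, driven by `|Γ| ≤ cC₁/ln³(e/r)`), and every blow-up
scenario (Hou, arXiv:2107.06509) keeps `Γ = O(1)` on the collapsing scale.  So the crux is cut into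

* `stub_katoAxisymSingularPoint` [M, KNOWN modulo tree facts] — Kato's `L³` theory in the
  axisymmetric class: if an axisymmetric weakly divergence-free `u₀ ∈ L³` has NO global Kato
  solution, then for some finite `T > 0` (namely `T_max(u₀)`) there is a Kato solution `u` on
  `[0, T)` (`IsKatoSolutionOn`) which is smooth on `(0, T) × ℝ³`, has axisymmetric slices for
  `0 < t < T`, and has a SINGULAR POINT `(T, x_*)`: `‖u‖_{L^∞(Q_r(T, x_*))} = ∞` for every `r > 0`
  (tree: `exists_singularPoint_katoMaximalTime` from `kato_local`,
  `IsKatoSolutionOn.continuation_of_bounded`, `IsKatoSolutionOn.farField_bound`; smoothing of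
  `C_t L³` mild solutions (Kato 1984, `MildL3Smooth`); axisymmetry propagates by rotation covariance
  of the equations + uniqueness `kato_unique_holds` + continuity of the smooth slices).
* `stub_logSwirlRegularity` [L, KNOWN IN ESSENCE — Seregin 2022 §2 Steps 2–4 (local, at axis
  points) + Caffarelli–Kohn–Nirenberg partial regularity with rotation invariance (off the axis),
  both to be run for Kato solutions, which are locally suitable after the Calderón/Rusin–Šverák
  splitting `u = e^{νtΔ}u₀ + w`, `w` of finite energy] — the REGULARITY CRITERION: an
  axisymmetric Kato solution on `[0, T)`, smooth on `(0, T) × ℝ³`, whose swirl satisfies the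
  logarithmic axis modulus `|Γ(t, x)| ≤ C / |log r|³` for `r = cylRadius x ≤ δ₀ < 1` uniformly in
  `t ∈ [t₀, T)`, is bounded near `(T, x₀)` for EVERY `x₀` (`IsBoundedNearTop`).
* `stub_swirlAxisModulus` [XL, OPEN — the load-bearing bet, = the crux's whole difficulty in
  a-priori form] — for an axisymmetric Kato solution on `[0, T)` from a datum represented in
  `Ḣ^{1/2}`, smooth on `(0, T) × ℝ³`, the swirl has that logarithmic modulus at the axis uniformly
  on every `[t₀, T)`, `0 < t₀ < T` (for `T < T_max` this is trivial from `|Γ| ≤ r‖u(t)‖_∞`; the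
  content is `T = T_max`).  Why it might fail: any blow-up with a non-trivial swirl profile on the
  collapsing scale (Hou's two-scale tornado) violates it; known only under Type-I / form-bounded
  control (Lei–Zhang 2011 Thm. 1.1, Seregin 2020) where `Γ` is even Hölder at the axis.

`AxisymmetricKatoGlobal_of : AxisymmetricKatoGlobal` (the ONLY theorem of this file concluding the
crux; conclusion = the crux BY NAME, no `Prop` hypotheses, placeholders only inside the three
declared stubs, which it uses by name) is the real composition: by contradiction, singular point
from stub 1, modulus on `[T/2, T)` from stub 3, local bound at `x_*` from stub 2, and the
measure-theoretic conversion "pointwise bound on the backward cylinder ⇒ finite `L^∞` norm of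
`uncurry u` on `parabolicCylinder r (T, x_*)`", contradicting `= ∞`.  Its CLOSED twin
`AxisymmetricKatoGlobal_of_hyps : <sig 1> → <sig 2> → <sig 3> → AxisymmetricKatoGlobal` (same proof,
the stub statements as hypotheses, no placeholder anywhere) is the registrar's evidence file
`bc/AxisymmetricKatoGlobal_birth_closed.lean` attached to the crux item.

## Reshape v2 (line lead prover-line-stmt-NavierStokesRegularity-15453-0, 2026-08-17, cycle 1)

Stub 2 of the birth certificate is split along its three mathematically distinct inputs, so that
each lands as an exact registered signature: `stub_sereginLogSwirlOrigin` (2a) is VERBATIM the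
local criterion of Seregin 2022 §2 in the tree's vocabulary (`SereginSverak2009.parCyl`,
`IsSuitableWeakSolutionOn`, `IsRegularAtOrigin`) — a literature fact, filed by the lead as the
named fact `seregin2022_logSwirl_regularAtOrigin` and closing by its `_holds`;
`stub_katoAxisymOffAxisBounded` (2b) is off-axis boundedness at the final time for axisymmetric
Kato solutions (CKN + rotation count; no swirl hypothesis); `stub_katoAxisBounded_of_origin` (2c)
is the transfer "2a ⇒ boundedness at axis points of Kato solutions under the log³ modulus"
(translation, parabolic rescaling, viscosity normalisation, Calderón splitting for suitability up
to the final time).  The former stub 2 is now the derived theorem `logSwirlRegularity`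
(cases on `cylRadius x₀ = 0`); the composition `AxisymmetricKatoGlobal_of` is unchanged.  Stubs:
1, 2a, 2b, 2c, 3 (5 ≤ stubs_max 7).

## Reshape v3 (line lead prover-line-stmt-NavierStokesRegularity-15453-c1-0, 2026-08-17, cycle 1 of the continuation)

Stubs 2b/2c of v2 both silently contained the same Kato-class input — "the local energy classes
of a Kato solution reach the final time" (Calderón / Rusin–Šverák splitting) — which is now its
own stub K `stub_katoLocalEnergyNearTop` (∃ an axisymmetric pressure making `(u, p)` suitable on
the open strip, with `sup_t ∫_{B_ρ}|u|²`, `∫∫_{B_ρ}|∇u|²`, `∫∫_{B_ρ}|p|^{3/2}` finite on every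
`(t₁, T) × B_ρ(0)`); 2b' `stub_offAxisBounded_of_localEnergy` and 2c'
`stub_axisBounded_of_localEnergy_origin` are the former 2b/2c with that input as a hypothesis —
pure statements about smooth axisymmetric suitable weak solutions below a final time, no Kato
vocabulary.  `logSwirlRegularity` is derived from K, 2a, 2b', 2c'; `AxisymmetricKatoGlobal_of` is
unchanged.  Stubs: 1, 2a, K, 2b', 2c', 3 (6 ≤ stubs_max 7).

Disproof used: none exists yet for this crux (`ledger crux ls`: no `Disproof.lean`, no dead lines);
negatives index (`ledger negatives --problem NavierStokesRegularity`, 4 entries) — no stub is an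
instance of a refuted statement (none concerns swirl moduli, Kato solutions or axisymmetric data).
Nearest in-tree statements deliberately NOT restated as stubs: `SwirlThreshold.SmallSwirlRegularity`
(ABSOLUTE small-swirl constant, flagged possibly false by its own route) — the criterion here is a
MODULUS at the axis, the printed (relative/local) form; `Literature…LeiZhang2017_logModulus_regularity`
/ `Wei2016_logModulus_regularity` (finite-energy classical solutions from rapidly decaying data) —
the stub is their Kato-class, local-in-`x₀` version, which is what the crux needs.
-/

noncomputable section

open Set MeasureTheory Filter Topology Function Metric
open scoped ENNReal NNReal
open Literature.Analysis.FluidPDE Literature.Analysis.FunctionSpaces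

namespace Summit.NavierStokesRegularity.NavierStokesRegularity.Cruxes.AxisymmetricKatoGlobal.Birth

set_option linter.unusedVariables false
set_option linter.dupNamespace false

local notation "ℝ³" => EuclideanSpace ℝ (Fin 3)

/-- **stub 1 — `stub_katoAxisymSingularPoint` (CLOSED: landed p149337, `Theorems/AxisymmetricExtremalityAxisymmetricKatoGlobalStubKatoAxisymSingularPoint.lean`; was M; known modulo the tree's Kato facts).**
Kato's `L³` theory in the axisymmetric class: no global Kato solution ⇒ a finite-time Kato solution
which is smooth and axisymmetric inside and has a singular point `(T, x_*)`
(`‖u‖_{L^∞(Q_r(T,x_*))} = ∞` for all `r > 0`; `Q_r(T,x_*) = (T − r², T) × B_r(x_*)` is the tree's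
`parabolicCylinder`).  Sources: Kato 1984 Thms 1–4; Lemarié-Rieusset 2016 Thm. 15.1 (C);
Rusin–Šverák arXiv:0911.0500 §4; tree `exists_singularPoint_katoMaximalTime`, `MildL3Smooth`,
`kato_unique_holds`, `IsClassicalNSSolutionOn.isAxisymmetric_of_data`. -/
theorem stub_katoAxisymSingularPoint :
    ∀ ν : ℝ, 0 < ν → ∀ u₀ : ℝ³ → ℝ³, MemLp u₀ 3 volume → IsWeaklyDivFree u₀ → IsAxisymmetric u₀ →
      ¬ HasGlobalKatoSolution ν u₀ →
      ∃ T : ℝ, 0 < T ∧ ∃ (xs : ℝ³) (u : ℝ → ℝ³ → ℝ³), IsKatoSolutionOn T ν u₀ u ∧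
        ContDiffOn ℝ (⊤ : ℕ∞) (uncurry u) (Ioo 0 T ×ˢ univ) ∧
        (∀ t ∈ Ioo 0 T, IsAxisymmetric (u t)) ∧
        ∀ r : ℝ, 0 < r → eLpNorm (uncurry u) ∞ (volume.restrict (parabolicCylinder r (T, xs))) = ∞ := by
  exact Theorems.AxisymmetricKatoGlobal.Registered.stub_katoAxisymSingularPoint

/-- **stub 2a — `stub_sereginLogSwirlOrigin` (LITERATURE FACT, verbatim the statement that the
lead files as the named fact `seregin2022_logSwirl_regularAtOrigin`; closes by `…_holds`).**
G. Seregin, *A note on local regularity of axisymmetric solutions to the Navier–Stokes equations*,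
J. Math. Fluid Mech. 24 (2022) = arXiv:2201.00153, §2 (proof of Thm. 1.2, Steps 1–4, run from the
swirl bound (2.2) `|σ| = |r v_θ| ≤ cC₁ / ln³(e/r)` in `𝒞`): an axially symmetric suitable weak
solution `(v, q)` (Def. 1.1: `v ∈ L_{2,∞}(Q)`, `∇v ∈ L₂(Q)`, `q ∈ L_{3/2}(Q)`, the equations in
distributions, the local energy inequality; `v` and `q` axially symmetric) of the Navier–Stokes
equations (`ν = 1`) in the unit cylinder `Q = 𝒞 × ]-1,0[` (`SereginSverak2009.parCyl 0 1`) whose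
swirl obeys `|Γ(t,x)| ≤ C₁ / ln³(e/|x'|)` in `Q` has the origin as a regular point
(`SereginSverak2009.IsRegularAtOrigin`: `v ∈ L^∞(Q(r))` for some `r > 0`).  Rendered with the
tree's LOCAL suitable class on the open cylinder plus the printed global classes on it, pointwise
axisymmetry of every slice of `v` and `q`, and the swirl bound off the axis (on the axis `Γ = 0`). -/
theorem stub_sereginLogSwirlOrigin :
    ∀ (v : ℝ → ℝ³ → ℝ³) (q : ℝ → ℝ³ → ℝ),
      IsSuitableWeakSolutionOn (SereginSverak2009.parCylOpens 0 1) 1 0 v q →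
      (∃ C : ℝ≥0, ∀ᵐ t ∂(volume.restrict (Ioo (-1 : ℝ) 0)),
          ∫⁻ x in SereginSverak2009.spaceCyl 0 1, ‖v t x‖ₑ ^ 2 ≤ C) →
      (∃ G : ℝ → ℝ³ → ℝ³ →L[ℝ] ℝ³,
          HasWeakSpatialGradientOn (SereginSverak2009.parCylOpens 0 1) v G ∧
          ∫⁻ z in SereginSverak2009.parCyl 0 1, ENNReal.ofReal (frobeniusNormSq (G z.1 z.2)) < ∞) →
      (∫⁻ z in SereginSverak2009.parCyl 0 1, ‖q z.1 z.2‖ₑ ^ (3 / 2 : ℝ) < ∞) →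
      (∀ t ∈ Ioo (-1 : ℝ) 0, IsAxisymmetric (v t)) →
      (∀ t ∈ Ioo (-1 : ℝ) 0, IsAxisymmetricScalar (q t)) →
      (∃ C₁ : ℝ, ∀ t ∈ Ioo (-1 : ℝ) 0, ∀ x ∈ SereginSverak2009.spaceCyl 0 1, 0 < cylRadius x →
          |swirl (v t) x| ≤ C₁ / Real.log (Real.exp 1 / cylRadius x) ^ 3) →
      SereginSverak2009.IsRegularAtOrigin v := by
  sorry

/-- **stub K — `stub_katoLocalEnergyNearTop` (CLOSED: landed p149176, `Theorems/AxisymmetricExtremalityAxisymmetricKatoGlobalStubKatoLocalEnergyNearTop.lean`; was L; KNOWN modulo tree facts — the Calderón /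
Rusin–Šverák splitting of a Kato solution UP TO THE FINAL TIME; reshape v3 by the lead c1).**
For `ν > 0`, `T > 0` and a Kato solution `u` on `[0, T)` which is smooth on `(0,T) × ℝ³` with
axisymmetric slices there is a pressure `p` (intended: the normalised / Riesz pressure
`p t = normalisedPressure (u t)`, axisymmetric by `IsAxisymmetric.isAxisymmetricScalar_normalisedPressure`,
a.e. the Riesz pressure `rieszPressure (u t)`) such that `(u, p)` is a suitable weak solution of
the unforced equations on the open strip `(0, T) × ℝ³` (`IsKatoSolutionOn.exists_rieszPressure_suitable_slab`
on every `(0, S)`, `S < T`, `IsSuitableWeakSolutionOn.congr_ae`, `.of_exhaustion`), and on every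
`(t₁, T) × B_ρ(0)`, `0 < t₁ < T`, the LOCAL ENERGY CLASSES REACH THE FINAL TIME:
`sup_{t₁<t<T} ∫_{B_ρ} |u(t)|² < ∞`, `∫_{t₁}^{T} ∫_{B_ρ} |∇u|² < ∞`, `∫_{t₁}^{T} ∫_{B_ρ} |p|^{3/2} < ∞`
(restart at a bounded slice `u(t₀)`, `0 < t₀ < t₁` — `IsKatoSolutionOn.restart`,
`.exists_ae_norm_le_of_pos` —, the energy bound of the caloric remainder
`w = u - e^{ν(t-t₀)Δ}u(t₀)` up to the final time `caloric_remainder_energy_bound`, the gradient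
bound of the caloric part of a bounded datum, `IsKatoSolutionOn.lintegral_enorm_cube_lt_top_of_ae_bounded`
and Stein `lintegral_rieszPressure_le`; Rusin–Šverák 2011 §4 p. 6, Lemarié-Rieusset 2016
Prop. 15.1 / Thm. 15.1). -/
theorem stub_katoLocalEnergyNearTop :
    ∀ ν : ℝ, 0 < ν → ∀ T : ℝ, 0 < T → ∀ (u₀ : ℝ³ → ℝ³) (u : ℝ → ℝ³ → ℝ³),
      IsKatoSolutionOn T ν u₀ u → ContDiffOn ℝ (⊤ : ℕ∞) (uncurry u) (Ioo 0 T ×ˢ univ) →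
      (∀ t ∈ Ioo 0 T, IsAxisymmetric (u t)) →
      ∃ p : ℝ → ℝ³ → ℝ,
        (∀ t ∈ Ioo 0 T, IsAxisymmetricScalar (p t)) ∧
        IsSuitableWeakSolutionOn (slab ℝ³ (Ioo 0 T) isOpen_Ioo) ν 0 u p ∧
        ∀ t₁ ∈ Ioo 0 T, ∀ ρ : ℝ, 0 < ρ →
          (∃ C : ℝ≥0, ∀ t ∈ Ioo t₁ T, ∫⁻ x in ball (0 : ℝ³) ρ, ‖u t x‖ₑ ^ 2 ≤ C) ∧
          (∫⁻ z in Ioo t₁ T ×ˢ ball (0 : ℝ³) ρ,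
              ENNReal.ofReal (frobeniusNormSq (fderiv ℝ (u z.1) z.2)) < ∞) ∧
          (∫⁻ z in Ioo t₁ T ×ˢ ball (0 : ℝ³) ρ, ‖p z.1 z.2‖ₑ ^ (3 / 2 : ℝ) < ∞) := by
  exact Theorems.AxisymmetricKatoGlobal.Registered.stub_katoLocalEnergyNearTop

/-- **stub 2b' — `stub_offAxisBounded_of_localEnergy` (CLOSED: landed p147674, `Theorems/AxisymmetricExtremalityAxisymmetricKatoGlobalStubOffAxisBoundedOfLocalEnergy.lean`; was M/L; KNOWN: Caffarelli–Kohn–Nirenberg /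
Seregin backward ε-regularity + rotation packing of the dissipation; reshape v3 — the former
stub 2b with the Kato input factored out through stub K).**  Let `(u, p)` be a suitable weak
solution of the unforced equations (viscosity `ν > 0`) on the open strip `(0, T) × ℝ³`, `u`
smooth there with axisymmetric slices, whose local energy classes reach the final time on
every `(t₁, T) × B_ρ(0)` (`sup_t ∫_{B_ρ}|u|²`, `∫∫_{B_ρ}|∇u|²`, `∫∫_{B_ρ}|p|^{3/2}` finite).
Then `u` is bounded near `(T, x₀)` for every `x₀` OFF the axis: the `N ~ ρ₀/r` rotated copies
of `Q_r(T, x₀)` are disjoint, lie in a bounded solid torus and carry the same dissipation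
(`setLIntegral_prod_ball_le_of_rot_invariant`, `IsAxisymmetric.frobeniusNormSq_fderiv_rotZ`), so
`r⁻¹ ∫_{Q_r(T,x₀)} |∇u|² → 0` and Seregin's backward criterion `seregin2014_thm14_holds`
(class `IsSuitableWeakSolutionInBall`) bounds `u` a.e. on a smaller backward cylinder — verbatim
the proof of `offAxis_regular` (`Seregin2020SingularSetAxis.lean`) /
`axisymmetricL3_boundedNearTop_offAxis_of_seregin`; the a.e. bound is an everywhere bound by
continuity below `T` (`SereginSverak2009.forall_le_of_ae_le_of_continuousOn`). -/
theorem stub_offAxisBounded_of_localEnergy :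
    ∀ ν : ℝ, 0 < ν → ∀ T : ℝ, 0 < T → ∀ (u : ℝ → ℝ³ → ℝ³) (p : ℝ → ℝ³ → ℝ),
      ContDiffOn ℝ (⊤ : ℕ∞) (uncurry u) (Ioo 0 T ×ˢ univ) →
      (∀ t ∈ Ioo 0 T, IsAxisymmetric (u t)) →
      IsSuitableWeakSolutionOn (slab ℝ³ (Ioo 0 T) isOpen_Ioo) ν 0 u p →
      (∀ t₁ ∈ Ioo 0 T, ∀ ρ : ℝ, 0 < ρ →
          (∃ C : ℝ≥0, ∀ t ∈ Ioo t₁ T, ∫⁻ x in ball (0 : ℝ³) ρ, ‖u t x‖ₑ ^ 2 ≤ C) ∧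
          (∫⁻ z in Ioo t₁ T ×ˢ ball (0 : ℝ³) ρ,
              ENNReal.ofReal (frobeniusNormSq (fderiv ℝ (u z.1) z.2)) < ∞) ∧
          (∫⁻ z in Ioo t₁ T ×ˢ ball (0 : ℝ³) ρ, ‖p z.1 z.2‖ₑ ^ (3 / 2 : ℝ) < ∞)) →
      ∀ x₀ : ℝ³, cylRadius x₀ ≠ 0 → IsBoundedNearTop u T x₀ := by
  exact Theorems.AxisymmetricKatoGlobal.Registered.stub_offAxisBounded_of_localEnergy

/-- **stub 2c' — `stub_axisBounded_of_localEnergy_origin` (CLOSED: landed p148895, `Theorems/AxisymmetricExtremalityAxisymmetricKatoGlobalStubAxisBoundedOfLocalEnergyOrigin.lean`; was M/L; KNOWN modulo tree facts: the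
transfer of the local criterion 2a to axis points; reshape v3 — the former stub 2c with the
Kato input factored out through stub K).**  IF the local criterion of stub 2a holds, then for a
suitable weak solution `(u, p)` on `(0, T) × ℝ³` (viscosity `ν > 0`), `u` smooth with
axisymmetric slices, `p` with axisymmetric slices, local energy classes reaching the final time
on every `(t₁, T) × B_ρ(0)`, and the logarithmic axis modulus of the swirl
`|Γ(t,x)| ≤ C / |log (cylRadius x)|³` for `cylRadius x ≤ δ₀ < 1`, `t ∈ [t₀, T)`: `u` is bounded
near `(T, x₀)` for every `x₀` ON the axis.  Proof: with `λ = min (δ₀, e⁻¹, √(ν(T - t₀)))/2`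
put `v = (λ/ν) • stPull (λ²/ν) λ T x₀ u`, `q = (λ/ν)² • stPull (λ²/ν) λ T x₀ p`
(`IsSuitableWeakSolutionOn.stRescale` with `α = λ/ν`, `γ = λ`, `β = λ²/ν`: viscosity `1`, force
`0`; `.of_le` to `parCylOpens 0 1 ⊆ stPreimage …` since `λ²/ν ≤ T`); the classes on the unit
cylinder come from those on `(T - λ²/ν, T) × B_{2λ}(x₀) ⊆ (t₁, T) × B_ρ(0)` by the change of
variables, the weak gradient of the smooth `v` is `fderiv` (`hasWeakSpatialGradientOn_of_contDiffOn`);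
`x₀` on the axis is fixed by every `rotZ θ`, so `v`, `q` have axisymmetric slices, and the swirl
is scale invariant: `swirl (v s) y = ν⁻¹ swirl (u t) (x₀ + λ y)`, whence
`|swirl (v s) y| ≤ (C/ν) / (log λ⁻¹ + log r⁻¹)³ ≤ (C/ν) / log³(e/r)` for `0 < r = cylRadius y < 1`
(`λ ≤ e⁻¹`); stub 2a gives `v ∈ L^∞(Q(r))`, transported back by
`eLpNorm_top_comp_stAffine_restrict_preimage` to a backward cylinder at `(T, x₀)`, and an a.e.
bound of the continuous `u` below `T` is an everywhere bound. -/
theorem stub_axisBounded_of_localEnergy_origin :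
    (∀ (v : ℝ → ℝ³ → ℝ³) (q : ℝ → ℝ³ → ℝ),
      IsSuitableWeakSolutionOn (SereginSverak2009.parCylOpens 0 1) 1 0 v q →
      (∃ C : ℝ≥0, ∀ᵐ t ∂(volume.restrict (Ioo (-1 : ℝ) 0)),
          ∫⁻ x in SereginSverak2009.spaceCyl 0 1, ‖v t x‖ₑ ^ 2 ≤ C) →
      (∃ G : ℝ → ℝ³ → ℝ³ →L[ℝ] ℝ³,
          HasWeakSpatialGradientOn (SereginSverak2009.parCylOpens 0 1) v G ∧
          ∫⁻ z in SereginSverak2009.parCyl 0 1, ENNReal.ofReal (frobeniusNormSq (G z.1 z.2)) < ∞) →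
      (∫⁻ z in SereginSverak2009.parCyl 0 1, ‖q z.1 z.2‖ₑ ^ (3 / 2 : ℝ) < ∞) →
      (∀ t ∈ Ioo (-1 : ℝ) 0, IsAxisymmetric (v t)) →
      (∀ t ∈ Ioo (-1 : ℝ) 0, IsAxisymmetricScalar (q t)) →
      (∃ C₁ : ℝ, ∀ t ∈ Ioo (-1 : ℝ) 0, ∀ x ∈ SereginSverak2009.spaceCyl 0 1, 0 < cylRadius x →
          |swirl (v t) x| ≤ C₁ / Real.log (Real.exp 1 / cylRadius x) ^ 3) →
      SereginSverak2009.IsRegularAtOrigin v) →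
    ∀ ν : ℝ, 0 < ν → ∀ T : ℝ, 0 < T → ∀ (u : ℝ → ℝ³ → ℝ³) (p : ℝ → ℝ³ → ℝ),
      ContDiffOn ℝ (⊤ : ℕ∞) (uncurry u) (Ioo 0 T ×ˢ univ) →
      (∀ t ∈ Ioo 0 T, IsAxisymmetric (u t)) →
      (∀ t ∈ Ioo 0 T, IsAxisymmetricScalar (p t)) →
      IsSuitableWeakSolutionOn (slab ℝ³ (Ioo 0 T) isOpen_Ioo) ν 0 u p →
      (∀ t₁ ∈ Ioo 0 T, ∀ ρ : ℝ, 0 < ρ →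
          (∃ C : ℝ≥0, ∀ t ∈ Ioo t₁ T, ∫⁻ x in ball (0 : ℝ³) ρ, ‖u t x‖ₑ ^ 2 ≤ C) ∧
          (∫⁻ z in Ioo t₁ T ×ˢ ball (0 : ℝ³) ρ,
              ENNReal.ofReal (frobeniusNormSq (fderiv ℝ (u z.1) z.2)) < ∞) ∧
          (∫⁻ z in Ioo t₁ T ×ˢ ball (0 : ℝ³) ρ, ‖p z.1 z.2‖ₑ ^ (3 / 2 : ℝ) < ∞)) →
      (∃ t₀ ∈ Ioo 0 T, ∃ C δ₀ : ℝ, 0 < δ₀ ∧ δ₀ < 1 ∧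
          ∀ t ∈ Ico t₀ T, ∀ x : ℝ³, cylRadius x ≤ δ₀ →
            |swirl (u t) x| ≤ C / |Real.log (cylRadius x)| ^ 3) →
      ∀ x₀ : ℝ³, cylRadius x₀ = 0 → IsBoundedNearTop u T x₀ := by
  exact Theorems.AxisymmetricKatoGlobal.Registered.stub_axisBounded_of_localEnergy_origin

/-- **The regularity criterion (former stub 2 `stub_logSwirlRegularity`, DERIVED from stubs
K, 2a, 2b', 2c').**  An axisymmetric Kato solution on `[0, T)`, smooth on `(0,T) × ℝ³`, whose
swirl `Γ = swirl (u t)` obeys `|Γ(t,x)| ≤ C / |log (cylRadius x)|³` for `cylRadius x ≤ δ₀ < 1`,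
uniformly in `t ∈ [t₀, T)`, is bounded near `(T, x₀)` for every `x₀` (`IsBoundedNearTop`): the
pressure and the local energy classes up to the final time come from stub K; off the axis by
stub 2b', on the axis by stub 2c' fed with stub 2a. -/
theorem logSwirlRegularity :
    ∀ ν : ℝ, 0 < ν → ∀ T : ℝ, 0 < T → ∀ (u₀ : ℝ³ → ℝ³) (u : ℝ → ℝ³ → ℝ³),
      IsKatoSolutionOn T ν u₀ u → ContDiffOn ℝ (⊤ : ℕ∞) (uncurry u) (Ioo 0 T ×ˢ univ) →
      (∀ t ∈ Ioo 0 T, IsAxisymmetric (u t)) →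
      (∃ t₀ ∈ Ioo 0 T, ∃ C δ₀ : ℝ, 0 < δ₀ ∧ δ₀ < 1 ∧
          ∀ t ∈ Ico t₀ T, ∀ x : ℝ³, cylRadius x ≤ δ₀ →
            |swirl (u t) x| ≤ C / |Real.log (cylRadius x)| ^ 3) →
      ∀ x₀ : ℝ³, IsBoundedNearTop u T x₀ := by
  intro ν hν T hT u₀ u hK hsm hax hmod x₀
  obtain ⟨p, hpax, hsw, hloc⟩ := stub_katoLocalEnergyNearTop ν hν T hT u₀ u hK hsm hax
  by_cases h0 : cylRadius x₀ = 0
  · exact stub_axisBounded_of_localEnergy_origin stub_sereginLogSwirlOrigin ν hν T hT u p hsm hax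
      hpax hsw hloc hmod x₀ h0
  · exact stub_offAxisBounded_of_localEnergy ν hν T hT u p hsm hax hsw hloc x₀ h0

/-- **stub 3 — `stub_swirlAxisModulus` (XL; OPEN — the load-bearing a-priori estimate).**
For an axisymmetric Kato solution on `[0, T)` from an `L³` datum represented in `Ḣ^{1/2}`, smooth on
`(0,T) × ℝ³`: on every `[t₀, T)`, `0 < t₀ < T`, the swirl has the logarithmic modulus
`|Γ(t,x)| ≤ C / |log r|³` at the axis (`r = cylRadius x ≤ δ₀`).  Trivial for `T < T_max(u₀)`; the
content is the maximal time.  Refuted by any blow-up with non-trivial swirl on the collapsing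
scale; known under Type-I / form-boundedness control (Lei–Zhang 2011 Thm. 1.1, Seregin 2020/2022). -/
theorem stub_swirlAxisModulus :
    ∀ ν : ℝ, 0 < ν → ∀ T : ℝ, 0 < T → ∀ (u₀ : ℝ³ → ℝ³)
      (g : HomSobolev ℝ³ (EuclideanSpace ℂ (Fin 3)) (1 / 2 : ℝ)) (u : ℝ → ℝ³ → ℝ³),
      g.Represents (Literature.Analysis.FunctionSpaces.EuclideanSpace.complexify ∘ u₀) →
      IsKatoSolutionOn T ν u₀ u → ContDiffOn ℝ (⊤ : ℕ∞) (uncurry u) (Ioo 0 T ×ˢ univ) →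
      (∀ t ∈ Ioo 0 T, IsAxisymmetric (u t)) →
      ∀ t₀ ∈ Ioo 0 T, ∃ C δ₀ : ℝ, 0 < δ₀ ∧ δ₀ < 1 ∧
        ∀ t ∈ Ico t₀ T, ∀ x : ℝ³, cylRadius x ≤ δ₀ →
          |swirl (u t) x| ≤ C / |Real.log (cylRadius x)| ^ 3 := by
  sorry

/-- A pointwise bound on the backward cylinder `(T − r², T) × B_r(x_*)` makes the `L^∞` norm of
`uncurry u` on the tree's `parabolicCylinder r (T, x_*)` finite (support lemma of the composition). -/
theorem eLpNorm_parabolicCylinder_lt_top_of_bound {u : ℝ → ℝ³ → ℝ³} {T r K : ℝ} {xs : ℝ³}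
    (h : ∀ t ∈ Ioo (T - r ^ 2) T, ∀ x ∈ ball xs r, ‖u t x‖ ≤ K) :
    eLpNorm (uncurry u) ∞ (volume.restrict (parabolicCylinder r (T, xs))) < ∞ := by
  have hmeas : MeasurableSet (parabolicCylinder r ((T, xs) : ℝ × ℝ³)) := by
    unfold parabolicCylinder
    exact measurableSet_Ioo.prod measurableSet_ball
  have hbound : ∀ᵐ z ∂(volume.restrict (parabolicCylinder r ((T, xs) : ℝ × ℝ³))), ‖uncurry u z‖ ≤ K := by
    filter_upwards [ae_restrict_mem hmeas] with z hz
    obtain ⟨ht, hx⟩ := mem_prod.1 hz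
    exact h z.1 ht z.2 hx
  rw [eLpNorm_exponent_top]
  exact (eLpNormEssSup_le_of_ae_bound hbound).trans_lt ENNReal.ofReal_lt_top

/-- **Birth composition (the skeleton theorem).** The crux BY NAME from the three registered stubs,
used by name: by contradiction — singular point (stub 1), axis modulus on `[T/2, T)` (stub 3), local
boundedness at the singular point (stub 2), finiteness of the `L^∞` norm on a backward cylinder. -/
theorem AxisymmetricKatoGlobal_of : Theses.AxisymmetricExtremality.AxisymmetricKatoGlobal := by
  have h1 := stub_katoAxisymSingularPoint
  have h2 := logSwirlRegularity
  have h3 := stub_swirlAxisModulus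
  intro ν hν u₀ g hL3 hrep hdiv hax
  -- the written-out rotation-equivariance of the crux is `IsAxisymmetric u₀` definitionally
  have hax' : IsAxisymmetric u₀ := fun θ x => hax θ x
  by_contra hng
  -- stub 1: a finite-time Kato solution, smooth and axisymmetric inside, singular at `(T, xs)`
  obtain ⟨T, hT, xs, u, hK, hsm, haxi, hsing⟩ := h1 ν hν u₀ hL3 hdiv hax' hng
  -- stub 3: the logarithmic modulus of the swirl at the axis on `[T/2, T)`
  have ht₀ : T / 2 ∈ Ioo 0 T := ⟨by linarith, by linarith⟩
  obtain ⟨C, δ₀, hδ₀, hδ₁, hmod⟩ := h3 ν hν T hT u₀ g u hrep hK hsm haxi (T / 2) ht₀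
  -- stub 2: hence every point, in particular `xs`, is bounded near the final time
  obtain ⟨r, hr, K, hbd⟩ := h2 ν hν T hT u₀ u hK hsm haxi ⟨T / 2, ht₀, C, δ₀, hδ₀, hδ₁, hmod⟩ xs
  -- contradiction with the singularity of `(T, xs)` at radius `r`
  exact absurd (hsing r hr) (eLpNorm_parabolicCylinder_lt_top_of_bound hbd).ne

end Summit.NavierStokesRegularity.NavierStokesRegularity.Cruxes.AxisymmetricKatoGlobal.Birth
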